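import Summits.QuantumFields.BalabanUV.Beta.GAN24.SecondOrderReadersParity
import Summits.QuantumFields.BalabanUV.Beta.SpineRecursivePureParity

/-!
# `BalabanUV.Beta.GAN24.SecondOrderCarrierParity` — row G-an2-4, the (α-0) exit of `CTW-DESIGN-ALPHA` (OWNER gan24-p1 g33's RULING
# R-gan24p1-g33-1 (C1) ∕ -A1 (2), IR-α0′), PART 2 of 2: **THE SECOND-ORDER CARRIER `W2OfK` IS ROW-PARITY-COVARIANT UP TO ITS SECOND-RESPONSE
# WORD** — the W-ASSEMBLY half of «does the W-recursion preserve row parity sector by sector», generic and at the literal `WrecAt`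

HONEST DEPENDENCY (page 1, mandatory): continuum YM on T⁴ ⇐ BetaPertH ∧ nine spine estimates (0/9 proved); BetaPertH ⇐ (D1) ∧ (D4) ∧
CAP+tail; G-an2-4 gates asym, D1 and NE2/3/4.  HONEST FRAMING (cell contract, verbatim): «discharging `BetaPertH` makes Bałaban's UV
stability UNCONDITIONAL — a real constructive-QFT result; it is NOT the continuum limit and NOT the Clay problem.»  THIS MODULE DISCHARGES
NOTHING of (Q-R) ∕ (LT) ∕ (DIV) ∕ (DL) ∕ «T2Shape» ∕ (hW, hWall), nothing of D1 ∕ BetaPertH: [folklore] kernel bookkeeping over an2's `SecondOrderResponse`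
carriers and `SpineRecursiveW` literal and the D1 lane's row-parity currency (`sgnK`, `trK`) BY NAME.  0 `def`, 0 `[cite:]`, 0 `def … : Prop`, 0 sorry;
no estimate of Bałaban's; not in print — our bookkeeping.  NEVER «G-an2-4 closed» as (CONV-C); NOT D1, NOT BetaPertH, NOT continuum, NOT Clay.
ABSOLUTE RULE (cell charter, verbatim): «No internally-minted statement may enter as a cited fact. Every hypothesis is either
kernel-proved in this package or a verbatim quotation of a PUBLISHED theorem with page reference. The manuscript(s) under audit are NOT
citable for their own disputed steps — they are the thing under adjudication; programme-internal (2001/route/tribunal) claims are never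
citable.»

CONTENTS (`X^P := sgnK (trK X)`, `X^{ev∕od} := ½•(X ± X^P)` entrywise; PART 1 = `GAN24/SecondOrderReadersParity`: the involution, the readers' covariance):
* §3 **THE CARRIER LAW** `sgnK_trK_W2OfK`: `S`, `M` row-parity-ODD, ANY `K`, `S₂`, `M₂` ⟹ `(W2OfK K N S M S₂ M₂ b b′)^P = W2OfK K N S M S₂^P M₂^P b b′
  − 2 • dM (K2OfK K N S M b′) N S M b` (PART 1 §2 + leaf-05's `parityOdd_dM` at `K′ := K2OfK … b′`); `sgnK_trK_W2SymOfK`.  THE HALVES (decaying `K`,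
  entrywise bounded `S₂`, `M₂` — leaf-05's `vertex2OfK_add_of_bdd ∕ mixOfK_add_of_bdd` hypotheses VERBATIM): **`evenHalf_W2OfK`** `= vertex2OfK S₂^{ev} +
  mixOfK M₂^{ev} + mixOfKᵀ M₂^{ev}` (NO second-response word), **`oddHalf_W2OfK`** `= W2OfK K N S M S₂^{od} M₂^{od}` (the FULL carrier — the second-response
  word lives entirely in the odd half); `evenHalf_W2SymOfK ∕ oddHalf_W2SymOfK`.
* §4 parity classes, no summability: `parityOdd_W2OfK_of_rows ∕ parityOdd_W2SymOfK_of_rows` (four odd-row tables ⟹ odd), `parityEven_W2OfK_sub_resp_of_rows ∕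
  parityEven_W2SymOfK_sub_resp_of_rows` (even-row `S₂ M₂`, odd-row `S M` ⟹ carrier minus response word even).
* §5 CLASS PRESERVATION, SAME CONSTANTS: `biLoc_sgnK_trK` (general points, swapped), `biLoc_half_add ∕ _sub`, `locStencil_sgnK_trK`, `locStencilFM_sgnK_trK
  ∕ _evenHalf ∕ _oddHalf`, **`vertexFamily₂_sgnK_trK_of_swap ∕ _evenHalf_of_swap ∕ _oddHalf_of_swap`** (swap-symmetric W-tables: `W2SymOfK_swap`, `WrecAt_swap`;
  the class of the even member's (hW) rows and of PARITY-JUNCTION's `X_j`).  The diagonal ∕ `LocStencil₂` versions are the OWNER's `GAN24/BiTableParityHalves`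
  (INTENT 4 l.49493) and d1-leaf-06's `WardLocusParitySplit.biLoc_oddHalf` — not restated.
* §6 AT THE LITERAL (`SpineRecursiveW`, in-block root, binders `hB hmix`): **`evenHalf_WrecAt`** `= W2SymOfK G_j Lc S_j M_j (T2RecAt … j)^{ev} (M2Of mixFF j)^{ev}
  − ½•(the two second-response words)` and **`oddHalf_WrecAt`** (the full symmetrised carrier on the odd halves); §3 at `K := G_j` (an2's
  `decays_coDressKBmAt_KInvStep`), `S_j`, `M_j` odd-row (d1-formalise-leaf-05's `trK_SpureRecAt ∕ trK_M1At`), bounds `T2RecAt_loc ∕ locStencilFM_M2Of`.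
READING (zero weight; (C1)'s W-assembly side in the strong form): each parity half of the W-table depends on the SAME half of the second-order tables
and first-order ∕ letter data only.  NOT HERE (the carve of W-1 l.49346 ∕ RULING -A1 (1)(2)): the T₂-STEP side (`K3OfK ∕ mmRead ∕ e4OfKW`, the double
words) and the literal's INDUCTION — gan24-p2 g44's `GAN24/EvenTowerAutonomy` (INTENT 3 l.49498).  Provenance: b2b-balaban G-an2-4 crux team (2), leaf
prover 03 gen 65, 2026-08-23 (v1); no existing file touched.
-/


noncomputable section

open Finset
open scoped BigOperators
open Literature.MathematicalPhysics.QuantumFieldTheory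
open Literature.MathematicalPhysics.QuantumFieldTheory.Balaban1983to89
open Literature.MathematicalPhysics.QuantumFieldTheory.Balaban1983to89.Beta
open ExpKernelCalculus (MKer Decays BiLoc VertexFamily₂ comp)
open B12Sec2to5 (l1)
open OneStepResolventKernel (Fib wsum LocStencil)
open BalabanCompositeJets (LocStencil₂)
open OneStepKernelFamily (colH vertexOfK KInvStep)
open AffineAveraging (box toSite)
open BalabanStepW2 (M2Of locStencilFM_M2Of)
open InterLevelTransport (cwsum cwsum_apply onLat)
open SecondOrderResponse (colM vertexOfM dM K2OfK vertex2OfK mixOfK W2OfK W2SymOfK W2OfK_apply LocStencilFM)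
open Summit.QuantumFields.BalabanUV.Beta.TameKernelCalculus
open Summit.QuantumFields.BalabanUV.Beta.BorderedHessian (sgnF sgnF_mul_self sgnK sgnK_apply sgnK_sgnK trK_sgnK comp_sgnK)
open Summit.QuantumFields.BalabanUV.Beta.SpineRecursiveParity (sgnK_smul trK_smul parityOdd_dM parityOdd_smul)
open Summit.QuantumFields.BalabanUV.Beta.KernelWardRemainderParity (sgnK_add trK_wsum sgnK_wsum sgnK_vertexOfK parityOdd_add
  trK_vertexOfK_eq_neg_sgnK_of_rows trK_vertexOfM_eq_neg_sgnK_of_rows)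
open Summit.QuantumFields.BalabanUV.Beta.BubbleParity (sgnK_neg)
open Summit.QuantumFields.BalabanUV.Beta.ChartConjugationReflection (trK_vertexOfK vertexOfK_neg)
open Summit.QuantumFields.BalabanUV.Beta.KernelWardCoarseExchange (trK_cwsum vertexOfM_neg smul_vertexOfM)
open Summit.QuantumFields.BalabanUV.Beta.WardLocusParitySplit (sgnK_sub parityOdd_oddHalf)
open Summit.QuantumFields.BalabanUV.Beta.SecondOrderRemainderTables (vertex2OfK_add_of_bdd mixOfK_add_of_bdd trK_vertex2OfK_of_rows
  trK_mixOfK_of_rows)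
open Summit.QuantumFields.BalabanUV.Beta.SecondOrderUnits (vertexOfK_smul_table vertexOfM_smul_table)
open Summit.QuantumFields.BalabanUV.Beta.GAN24.Lin4Additive (vertex2OfK_smul)

open Summit.QuantumFields.BalabanUV.Beta.AxialDressingRooted (coDressKBmAt decays_coDressKBmAt_KInvStep)
open Summit.QuantumFields.BalabanUV.Beta.SpineRooted (SpureRecAt M1At T2RecAt WrecAt T2RecAt_loc)
open Summit.QuantumFields.BalabanUV.Beta.SpineRecursivePureParity (trK_SpureRecAt)
open Summit.QuantumFields.BalabanUV.Beta.SpineRecursiveParity (trK_M1At)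
open Summit.QuantumFields.BalabanUV.Beta.SecondOrderRemainderTables (abs_le_of_locStencil₂ abs_le_of_locStencilFM)
open Summit.QuantumFields.BalabanUV.Beta.GAN24.SecondOrderReadersParity

namespace Summit.QuantumFields.BalabanUV.Beta.GAN24.SecondOrderCarrierParity

variable {d : ℕ}

/-! ## §3 The carrier law and the halves -/

section Carrier

variable {N : ℕ} [NeZero N] {K : MKer (d + 1) (Fib d)} {S M : Fin (d + 1) → (Fin (d + 1) → ℤ) → MKer (d + 1) (Fib d)}

/-- [folklore] **THE CARRIER LAW: `W2OfK` IS PARITY-COVARIANT UP TO ITS SECOND-RESPONSE WORD.**  For row-parity-ODD first-order tables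
`S`, `M` and ANY weight kernel `K` and second-order tables `S₂`, `M₂`:
`(W2OfK K N S M S₂ M₂ b b′)^P = W2OfK K N S M S₂^P M₂^P b b′ − 2 • dM (K2OfK K N S M b′) N S M b`. -/
theorem sgnK_trK_W2OfK (hS : ∀ κ u, trK (S κ u) = -sgnK (S κ u)) (hM : ∀ ρ w, trK (M ρ w) = -sgnK (M ρ w))
    (S₂ M₂ : Fin (d + 1) → (Fin (d + 1) → ℤ) → Fin (d + 1) → (Fin (d + 1) → ℤ) → MKer (d + 1) (Fib d))
    (μ : Fin (d + 1)) (y : Fin (d + 1) → ℤ) (ν : Fin (d + 1)) (y' : Fin (d + 1) → ℤ) :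
    sgnK (trK (W2OfK K N S M S₂ M₂ μ y ν y')) =
      W2OfK K N S M (fun κ u κ' u' => sgnK (trK (S₂ κ u κ' u'))) (fun κ u ρ w => sgnK (trK (M₂ κ u ρ w))) μ y ν y'
        - (2 : ℝ) • dM (K2OfK K N S M ν y') N S M μ y := by
  have hD : sgnK (trK (dM (K2OfK K N S M ν y') N S M μ y)) = -dM (K2OfK K N S M ν y') N S M μ y :=
    (parityOdd_iff _).1 (parityOdd_dM (K2OfK K N S M ν y') N hS hM μ y)
  rw [W2OfK_apply, W2OfK_apply, sgnK_trK_add, sgnK_trK_add, sgnK_trK_add, sgnK_trK_vertex2OfK, sgnK_trK_mixOfK, sgnK_trK_mixOfK,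
    hD, two_smul]
  abel

/-- [folklore] **THE SWAP-SYMMETRISED CARRIER LAW**: `(W2SymOfK … b b′)^P = W2SymOfK K N S M S₂^P M₂^P b b′ − (dM (K2OfK … b′) N S M b + dM (K2OfK … b) N S M b′)`. -/
theorem sgnK_trK_W2SymOfK (hS : ∀ κ u, trK (S κ u) = -sgnK (S κ u)) (hM : ∀ ρ w, trK (M ρ w) = -sgnK (M ρ w))
    (S₂ M₂ : Fin (d + 1) → (Fin (d + 1) → ℤ) → Fin (d + 1) → (Fin (d + 1) → ℤ) → MKer (d + 1) (Fib d))
    (μ : Fin (d + 1)) (y : Fin (d + 1) → ℤ) (ν : Fin (d + 1)) (y' : Fin (d + 1) → ℤ) :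
    sgnK (trK (W2SymOfK K N S M S₂ M₂ μ y ν y')) =
      W2SymOfK K N S M (fun κ u κ' u' => sgnK (trK (S₂ κ u κ' u'))) (fun κ u ρ w => sgnK (trK (M₂ κ u ρ w))) μ y ν y'
        - (dM (K2OfK K N S M ν y') N S M μ y + dM (K2OfK K N S M μ y) N S M ν y') := by
  unfold SecondOrderResponse.W2SymOfK
  rw [sgnK_trK_smul, sgnK_trK_add, sgnK_trK_W2OfK hS hM, sgnK_trK_W2OfK hS hM]
  funext x z a b
  simp only [Pi.smul_apply, Pi.add_apply, Pi.sub_apply, smul_eq_mul]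
  ring

variable (hK : ∃ δ C : ℝ, 0 < δ ∧ 0 ≤ C ∧ Decays K C δ)
include hK

/-- [folklore] **THE EVEN HALF OF THE CARRIER IS THE CARRIER WITHOUT ITS SECOND-RESPONSE WORD, ON THE EVEN TABLES**:
`½ • (W + W^P) = vertex2OfK K N S₂^{ev} b b′ + mixOfK K N M₂^{ev} b b′ + mixOfK K N M₂^{ev} b′ b` (decaying `K`, entrywise bounded `S₂`, `M₂`;
`X^{ev} := ½ • (X + X^P)` entrywise). -/
theorem evenHalf_W2OfK (hS : ∀ κ u, trK (S κ u) = -sgnK (S κ u)) (hM : ∀ ρ w, trK (M ρ w) = -sgnK (M ρ w))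
    {S₂ M₂ : Fin (d + 1) → (Fin (d + 1) → ℤ) → Fin (d + 1) → (Fin (d + 1) → ℤ) → MKer (d + 1) (Fib d)} {B₂ BM : ℝ}
    (hS₂ : ∀ κ u κ' u' x z a b, |S₂ κ u κ' u' x z a b| ≤ B₂) (hM₂ : ∀ κ u ρ w x z a b, |M₂ κ u ρ w x z a b| ≤ BM)
    (μ : Fin (d + 1)) (y : Fin (d + 1) → ℤ) (ν : Fin (d + 1)) (y' : Fin (d + 1) → ℤ) :
    (1 / 2 : ℝ) • (W2OfK K N S M S₂ M₂ μ y ν y' + sgnK (trK (W2OfK K N S M S₂ M₂ μ y ν y'))) =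
      vertex2OfK K N (fun κ u κ' u' => (1 / 2 : ℝ) • (S₂ κ u κ' u' + sgnK (trK (S₂ κ u κ' u')))) μ y ν y'
        + mixOfK K N (fun κ u ρ w => (1 / 2 : ℝ) • (M₂ κ u ρ w + sgnK (trK (M₂ κ u ρ w)))) μ y ν y'
        + mixOfK K N (fun κ u ρ w => (1 / 2 : ℝ) • (M₂ κ u ρ w + sgnK (trK (M₂ κ u ρ w)))) ν y' μ y := by
  have hS₂' : ∀ κ u κ' u' x z a b, |sgnK (trK (S₂ κ u κ' u')) x z a b| ≤ B₂ := fun κ u κ' u' x z a b => by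
    rw [abs_sgnK_trK_apply]; exact hS₂ κ u κ' u' z x b a
  have hM₂' : ∀ κ u ρ w x z a b, |sgnK (trK (M₂ κ u ρ w)) x z a b| ≤ BM := fun κ u ρ w x z a b => by
    rw [abs_sgnK_trK_apply]; exact hM₂ κ u ρ w z x b a
  rw [sgnK_trK_W2OfK hS hM, vertex2OfK_smul', mixOfK_smul, mixOfK_smul, vertex2OfK_add_of_bdd hK hS₂ hS₂',
    mixOfK_add_of_bdd hK hM₂ hM₂', mixOfK_add_of_bdd hK hM₂ hM₂', W2OfK_apply, W2OfK_apply]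
  funext x z a b
  simp only [Pi.smul_apply, Pi.add_apply, Pi.sub_apply, smul_eq_mul]
  ring

/-- [folklore] **THE ODD HALF OF THE CARRIER IS THE FULL CARRIER ON THE ODD TABLES** (the second-response word lives entirely here):
`½ • (W − W^P) = W2OfK K N S M S₂^{od} M₂^{od} b b′` (`X^{od} := ½ • (X − X^P)` entrywise). -/
theorem oddHalf_W2OfK (hS : ∀ κ u, trK (S κ u) = -sgnK (S κ u)) (hM : ∀ ρ w, trK (M ρ w) = -sgnK (M ρ w))
    {S₂ M₂ : Fin (d + 1) → (Fin (d + 1) → ℤ) → Fin (d + 1) → (Fin (d + 1) → ℤ) → MKer (d + 1) (Fib d)} {B₂ BM : ℝ}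
    (hS₂ : ∀ κ u κ' u' x z a b, |S₂ κ u κ' u' x z a b| ≤ B₂) (hM₂ : ∀ κ u ρ w x z a b, |M₂ κ u ρ w x z a b| ≤ BM)
    (μ : Fin (d + 1)) (y : Fin (d + 1) → ℤ) (ν : Fin (d + 1)) (y' : Fin (d + 1) → ℤ) :
    (1 / 2 : ℝ) • (W2OfK K N S M S₂ M₂ μ y ν y' - sgnK (trK (W2OfK K N S M S₂ M₂ μ y ν y'))) =
      W2OfK K N S M (fun κ u κ' u' => (1 / 2 : ℝ) • (S₂ κ u κ' u' - sgnK (trK (S₂ κ u κ' u'))))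
        (fun κ u ρ w => (1 / 2 : ℝ) • (M₂ κ u ρ w - sgnK (trK (M₂ κ u ρ w)))) μ y ν y' := by
  have hS₂' : ∀ κ u κ' u' x z a b, |(-sgnK (trK (S₂ κ u κ' u'))) x z a b| ≤ B₂ := fun κ u κ' u' x z a b => by
    rw [Pi.neg_apply, Pi.neg_apply, Pi.neg_apply, Pi.neg_apply, abs_neg, abs_sgnK_trK_apply]; exact hS₂ κ u κ' u' z x b a
  have hM₂' : ∀ κ u ρ w x z a b, |(-sgnK (trK (M₂ κ u ρ w))) x z a b| ≤ BM := fun κ u ρ w x z a b => by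
    rw [Pi.neg_apply, Pi.neg_apply, Pi.neg_apply, Pi.neg_apply, abs_neg, abs_sgnK_trK_apply]; exact hM₂ κ u ρ w z x b a
  have e₂ : (fun κ u κ' u' => (1 / 2 : ℝ) • (S₂ κ u κ' u' - sgnK (trK (S₂ κ u κ' u')))) =
      fun κ u κ' u' => (1 / 2 : ℝ) • (S₂ κ u κ' u' + -sgnK (trK (S₂ κ u κ' u'))) := by
    funext κ u κ' u'; rw [sub_eq_add_neg]
  have eM : (fun κ u ρ w => (1 / 2 : ℝ) • (M₂ κ u ρ w - sgnK (trK (M₂ κ u ρ w)))) =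
      fun κ u ρ w => (1 / 2 : ℝ) • (M₂ κ u ρ w + -sgnK (trK (M₂ κ u ρ w))) := by
    funext κ u ρ w; rw [sub_eq_add_neg]
  rw [sgnK_trK_W2OfK hS hM, e₂, eM, W2OfK_apply, W2OfK_apply, W2OfK_apply, vertex2OfK_smul', mixOfK_smul, mixOfK_smul,
    vertex2OfK_add_of_bdd hK hS₂ hS₂', mixOfK_add_of_bdd hK hM₂ hM₂', mixOfK_add_of_bdd hK hM₂ hM₂', vertex2OfK_neg, mixOfK_neg, mixOfK_neg]
  funext x z a b
  simp only [Pi.smul_apply, Pi.add_apply, Pi.sub_apply, Pi.neg_apply, smul_eq_mul]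
  ring

/-- [folklore] **THE EVEN HALF OF THE SWAP-SYMMETRISED CARRIER**: `½ • (W2Sym + W2Sym^P) = W2SymOfK K N S M S₂^{ev} M₂^{ev} b b′ − ½ • (dM (K2OfK … b′) N S M b
+ dM (K2OfK … b) N S M b′)` — the symmetrised carrier on the even tables minus its (symmetrised) second-response word. -/
theorem evenHalf_W2SymOfK (hS : ∀ κ u, trK (S κ u) = -sgnK (S κ u)) (hM : ∀ ρ w, trK (M ρ w) = -sgnK (M ρ w))
    {S₂ M₂ : Fin (d + 1) → (Fin (d + 1) → ℤ) → Fin (d + 1) → (Fin (d + 1) → ℤ) → MKer (d + 1) (Fib d)} {B₂ BM : ℝ}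
    (hS₂ : ∀ κ u κ' u' x z a b, |S₂ κ u κ' u' x z a b| ≤ B₂) (hM₂ : ∀ κ u ρ w x z a b, |M₂ κ u ρ w x z a b| ≤ BM)
    (μ : Fin (d + 1)) (y : Fin (d + 1) → ℤ) (ν : Fin (d + 1)) (y' : Fin (d + 1) → ℤ) :
    (1 / 2 : ℝ) • (W2SymOfK K N S M S₂ M₂ μ y ν y' + sgnK (trK (W2SymOfK K N S M S₂ M₂ μ y ν y'))) =
      W2SymOfK K N S M (fun κ u κ' u' => (1 / 2 : ℝ) • (S₂ κ u κ' u' + sgnK (trK (S₂ κ u κ' u'))))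
          (fun κ u ρ w => (1 / 2 : ℝ) • (M₂ κ u ρ w + sgnK (trK (M₂ κ u ρ w)))) μ y ν y'
        - (1 / 2 : ℝ) • (dM (K2OfK K N S M ν y') N S M μ y + dM (K2OfK K N S M μ y) N S M ν y') := by
  have h1 := evenHalf_W2OfK (N := N) hK hS hM hS₂ hM₂ μ y ν y'
  have h2 := evenHalf_W2OfK (N := N) hK hS hM hS₂ hM₂ ν y' μ y
  rw [sgnK_trK_W2OfK hS hM] at h1 h2
  unfold SecondOrderResponse.W2SymOfK
  rw [sgnK_trK_smul, sgnK_trK_add, sgnK_trK_W2OfK hS hM, sgnK_trK_W2OfK hS hM, W2OfK_apply (S₂ := fun κ u κ' u' =>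
      (1 / 2 : ℝ) • (S₂ κ u κ' u' + sgnK (trK (S₂ κ u κ' u')))), W2OfK_apply (S₂ := fun κ u κ' u' =>
      (1 / 2 : ℝ) • (S₂ κ u κ' u' + sgnK (trK (S₂ κ u κ' u')))), ← h1, ← h2]
  funext x z a b
  simp only [Pi.smul_apply, Pi.add_apply, Pi.sub_apply, smul_eq_mul]
  ring

/-- [folklore] **THE ODD HALF OF THE SWAP-SYMMETRISED CARRIER IS THE FULL SYMMETRISED CARRIER ON THE ODD TABLES.** -/
theorem oddHalf_W2SymOfK (hS : ∀ κ u, trK (S κ u) = -sgnK (S κ u)) (hM : ∀ ρ w, trK (M ρ w) = -sgnK (M ρ w))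
    {S₂ M₂ : Fin (d + 1) → (Fin (d + 1) → ℤ) → Fin (d + 1) → (Fin (d + 1) → ℤ) → MKer (d + 1) (Fib d)} {B₂ BM : ℝ}
    (hS₂ : ∀ κ u κ' u' x z a b, |S₂ κ u κ' u' x z a b| ≤ B₂) (hM₂ : ∀ κ u ρ w x z a b, |M₂ κ u ρ w x z a b| ≤ BM)
    (μ : Fin (d + 1)) (y : Fin (d + 1) → ℤ) (ν : Fin (d + 1)) (y' : Fin (d + 1) → ℤ) :
    (1 / 2 : ℝ) • (W2SymOfK K N S M S₂ M₂ μ y ν y' - sgnK (trK (W2SymOfK K N S M S₂ M₂ μ y ν y'))) =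
      W2SymOfK K N S M (fun κ u κ' u' => (1 / 2 : ℝ) • (S₂ κ u κ' u' - sgnK (trK (S₂ κ u κ' u'))))
        (fun κ u ρ w => (1 / 2 : ℝ) • (M₂ κ u ρ w - sgnK (trK (M₂ κ u ρ w)))) μ y ν y' := by
  have h1 := oddHalf_W2OfK (N := N) hK hS hM hS₂ hM₂ μ y ν y'
  have h2 := oddHalf_W2OfK (N := N) hK hS hM hS₂ hM₂ ν y' μ y
  rw [sgnK_trK_W2OfK hS hM] at h1 h2
  unfold SecondOrderResponse.W2SymOfK
  rw [sgnK_trK_smul, sgnK_trK_add, sgnK_trK_W2OfK hS hM, sgnK_trK_W2OfK hS hM, ← h1, ← h2]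
  funext x z a b
  simp only [Pi.smul_apply, Pi.add_apply, Pi.sub_apply, smul_eq_mul]
  ring

end Carrier

/-! ## §4 Parity-class corollaries (no summability) -/

section Classes

variable {N : ℕ} {K : MKer (d + 1) (Fib d)} {S M : Fin (d + 1) → (Fin (d + 1) → ℤ) → MKer (d + 1) (Fib d)}
  {S₂ M₂ : Fin (d + 1) → (Fin (d + 1) → ℤ) → Fin (d + 1) → (Fin (d + 1) → ℤ) → MKer (d + 1) (Fib d)}

/-- [folklore] **ALL FOUR TABLES ODD-ROW ⟹ THE CARRIER IS PARITY-ODD** (any weight kernel): leaf-05's slot parities + `parityOdd_dM`. -/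
theorem parityOdd_W2OfK_of_rows (hS : ∀ κ u, trK (S κ u) = -sgnK (S κ u)) (hM : ∀ ρ w, trK (M ρ w) = -sgnK (M ρ w))
    (hS₂ : ∀ κ u κ' u', trK (S₂ κ u κ' u') = -sgnK (S₂ κ u κ' u')) (hM₂ : ∀ κ u ρ w, trK (M₂ κ u ρ w) = -sgnK (M₂ κ u ρ w))
    (μ : Fin (d + 1)) (y : Fin (d + 1) → ℤ) (ν : Fin (d + 1)) (y' : Fin (d + 1) → ℤ) :
    trK (W2OfK K N S M S₂ M₂ μ y ν y') = -sgnK (W2OfK K N S M S₂ M₂ μ y ν y') := by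
  rw [W2OfK_apply]
  exact parityOdd_add (parityOdd_add (parityOdd_add (trK_vertex2OfK_of_rows (N := N) K hS₂ μ y ν y')
    (trK_mixOfK_of_rows (N := N) K hM₂ μ y ν y')) (trK_mixOfK_of_rows (N := N) K hM₂ ν y' μ y))
    (parityOdd_dM (K2OfK K N S M ν y') N hS hM μ y)

/-- [folklore] The swap-symmetrised twin: all four tables odd-row ⟹ `W2SymOfK` is parity-odd. -/
theorem parityOdd_W2SymOfK_of_rows (hS : ∀ κ u, trK (S κ u) = -sgnK (S κ u)) (hM : ∀ ρ w, trK (M ρ w) = -sgnK (M ρ w))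
    (hS₂ : ∀ κ u κ' u', trK (S₂ κ u κ' u') = -sgnK (S₂ κ u κ' u')) (hM₂ : ∀ κ u ρ w, trK (M₂ κ u ρ w) = -sgnK (M₂ κ u ρ w))
    (μ : Fin (d + 1)) (y : Fin (d + 1) → ℤ) (ν : Fin (d + 1)) (y' : Fin (d + 1) → ℤ) :
    trK (W2SymOfK K N S M S₂ M₂ μ y ν y') = -sgnK (W2SymOfK K N S M S₂ M₂ μ y ν y') := by
  unfold SecondOrderResponse.W2SymOfK
  exact parityOdd_smul _ (parityOdd_add (parityOdd_W2OfK_of_rows hS hM hS₂ hM₂ μ y ν y') (parityOdd_W2OfK_of_rows hS hM hS₂ hM₂ ν y' μ y))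

/-- [folklore] **EVEN-ROW SECOND-ORDER TABLES, ODD-ROW FIRST-ORDER TABLES ⟹ THE CARRIER MINUS ITS SECOND-RESPONSE WORD IS PARITY-EVEN**
(any weight kernel). -/
theorem parityEven_W2OfK_sub_resp_of_rows [NeZero N]
    (hS₂ : ∀ κ u κ' u', trK (S₂ κ u κ' u') = sgnK (S₂ κ u κ' u')) (hM₂ : ∀ κ u ρ w, trK (M₂ κ u ρ w) = sgnK (M₂ κ u ρ w))
    (μ : Fin (d + 1)) (y : Fin (d + 1) → ℤ) (ν : Fin (d + 1)) (y' : Fin (d + 1) → ℤ) :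
    trK (W2OfK K N S M S₂ M₂ μ y ν y' - dM (K2OfK K N S M ν y') N S M μ y) =
      sgnK (W2OfK K N S M S₂ M₂ μ y ν y' - dM (K2OfK K N S M ν y') N S M μ y) := by
  rw [W2OfK_apply, add_sub_cancel_right, trK_add, trK_add, sgnK_add, sgnK_add, parityEven_vertex2OfK_of_rows K hS₂,
    parityEven_mixOfK_of_rows K hM₂, parityEven_mixOfK_of_rows K hM₂]

/-- [folklore] The swap-symmetrised twin: even-row `S₂`, `M₂` ⟹ `W2SymOfK − ½ • (dM (K2OfK … b′) N S M b + dM (K2OfK … b) N S M b′)` is parity-even. -/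
theorem parityEven_W2SymOfK_sub_resp_of_rows [NeZero N]
    (hS₂ : ∀ κ u κ' u', trK (S₂ κ u κ' u') = sgnK (S₂ κ u κ' u')) (hM₂ : ∀ κ u ρ w, trK (M₂ κ u ρ w) = sgnK (M₂ κ u ρ w))
    (μ : Fin (d + 1)) (y : Fin (d + 1) → ℤ) (ν : Fin (d + 1)) (y' : Fin (d + 1) → ℤ) :
    trK (W2SymOfK K N S M S₂ M₂ μ y ν y' - (1 / 2 : ℝ) • (dM (K2OfK K N S M ν y') N S M μ y + dM (K2OfK K N S M μ y) N S M ν y')) =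
      sgnK (W2SymOfK K N S M S₂ M₂ μ y ν y'
        - (1 / 2 : ℝ) • (dM (K2OfK K N S M ν y') N S M μ y + dM (K2OfK K N S M μ y) N S M ν y')) := by
  have e : W2SymOfK K N S M S₂ M₂ μ y ν y' - (1 / 2 : ℝ) • (dM (K2OfK K N S M ν y') N S M μ y + dM (K2OfK K N S M μ y) N S M ν y')
      = (1 / 2 : ℝ) • ((W2OfK K N S M S₂ M₂ μ y ν y' - dM (K2OfK K N S M ν y') N S M μ y)
          + (W2OfK K N S M S₂ M₂ ν y' μ y - dM (K2OfK K N S M μ y) N S M ν y')) := by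
    unfold SecondOrderResponse.W2SymOfK
    rw [← smul_sub]
    congr 1
    abel
  rw [e, trK_smul, sgnK_smul, trK_add, sgnK_add, parityEven_W2OfK_sub_resp_of_rows hS₂ hM₂, parityEven_W2OfK_sub_resp_of_rows hS₂ hM₂]

end Classes


/-! ## §5 The involution and the halves preserve the localisation classes (same constants) -/

section Classes₂

variable {N : ℕ}

/-- [folklore] **THE INVOLUTION SWAPS THE LOCALISATION POINTS AND KEEPS THE CONSTANTS**: `BiLoc K p q C δ ⟹ BiLoc K^P q p C δ`. -/
theorem biLoc_sgnK_trK {K : MKer (d + 1) (Fib d)} {p q : Fin (d + 1) → ℤ} {C δ : ℝ} (h : BiLoc K p q C δ) :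
    BiLoc (sgnK (trK K)) q p C δ := by
  intro x z a b
  rw [abs_sgnK_trK_apply, add_comm (l1 (x - q))]
  exact h z x b a

/-- [folklore] The mean of two kernels in one `BiLoc` class is in the class. -/
theorem biLoc_half_add {K L : MKer (d + 1) (Fib d)} {p q : Fin (d + 1) → ℤ} {C δ : ℝ} (hK : BiLoc K p q C δ) (hL : BiLoc L p q C δ) :
    BiLoc ((1 / 2 : ℝ) • (K + L)) p q C δ := by
  intro x z a b
  have h1 := hK x z a b
  have h2 := hL x z a b
  simp only [Pi.smul_apply, Pi.add_apply, smul_eq_mul]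
  rw [abs_mul, abs_of_pos (by norm_num : (0 : ℝ) < 1 / 2)]
  have h3 := abs_add_le (K x z a b) (L x z a b)
  nlinarith [h3, h1, h2, abs_nonneg (K x z a b + L x z a b)]

/-- [folklore] The half-difference of two kernels in one `BiLoc` class is in the class. -/
theorem biLoc_half_sub {K L : MKer (d + 1) (Fib d)} {p q : Fin (d + 1) → ℤ} {C δ : ℝ} (hK : BiLoc K p q C δ) (hL : BiLoc L p q C δ) :
    BiLoc ((1 / 2 : ℝ) • (K - L)) p q C δ := by
  intro x z a b
  have h1 := hK x z a b
  have h2 := hL x z a b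
  simp only [Pi.smul_apply, Pi.sub_apply, smul_eq_mul]
  rw [abs_mul, abs_of_pos (by norm_num : (0 : ℝ) < 1 / 2)]
  have h3 := abs_sub (K x z a b) (L x z a b)
  nlinarith [h3, h1, h2, abs_nonneg (K x z a b - L x z a b)]

/-- [folklore] The involution preserves `LocStencil` (same constants). -/
theorem locStencil_sgnK_trK {S : Fin (d + 1) → (Fin (d + 1) → ℤ) → MKer (d + 1) (Fib d)} {Cs δ : ℝ} (h : LocStencil S Cs δ) :
    LocStencil (fun κ u => sgnK (trK (S κ u))) Cs δ :=
  fun κ u => biLoc_sgnK_trK (h κ u)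

/-- [folklore] The involution preserves `LocStencilFM` (same constants). -/
theorem locStencilFM_sgnK_trK {M₂ : Fin (d + 1) → (Fin (d + 1) → ℤ) → Fin (d + 1) → (Fin (d + 1) → ℤ) → MKer (d + 1) (Fib d)} {C δ : ℝ}
    (h : LocStencilFM N M₂ C δ) : LocStencilFM N (fun κ u ρ w => sgnK (trK (M₂ κ u ρ w))) C δ :=
  fun κ u ρ w => biLoc_sgnK_trK (h κ u ρ w)

/-- [folklore] **THE INVOLUTION PRESERVES `VertexFamily₂` FOR SWAP-SYMMETRIC TABLES (SAME CONSTANTS)**: the leg swap lands on the member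
with the two coarse bonds exchanged (`W2SymOfK_swap`, `SpineRecursiveW.WrecAt_swap` are the swap symmetries of record). -/
theorem vertexFamily₂_sgnK_trK_of_swap {W : Fin (d + 1) → (Fin (d + 1) → ℤ) → Fin (d + 1) → (Fin (d + 1) → ℤ) → MKer (d + 1) (Fib d)}
    {Cw δ : ℝ} (hs : ∀ μ y ν y', W ν y' μ y = W μ y ν y') (h : VertexFamily₂ W N Cw δ) :
    VertexFamily₂ (fun μ y ν y' => sgnK (trK (W μ y ν y'))) N Cw δ := by
  intro μ y ν y'
  show BiLoc (sgnK (trK (W μ y ν y'))) _ _ Cw δ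
  rw [← hs μ y ν y']
  exact biLoc_sgnK_trK (h ν y' μ y)

/-- [folklore] The even halves of a `LocStencilFM` family form a `LocStencilFM` family (same constants). -/
theorem locStencilFM_evenHalf {M₂ : Fin (d + 1) → (Fin (d + 1) → ℤ) → Fin (d + 1) → (Fin (d + 1) → ℤ) → MKer (d + 1) (Fib d)} {C δ : ℝ}
    (h : LocStencilFM N M₂ C δ) : LocStencilFM N (fun κ u ρ w => (1 / 2 : ℝ) • (M₂ κ u ρ w + sgnK (trK (M₂ κ u ρ w)))) C δ :=
  fun κ u ρ w => biLoc_half_add (h κ u ρ w) (biLoc_sgnK_trK (h κ u ρ w))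

/-- [folklore] The odd halves of a `LocStencilFM` family form a `LocStencilFM` family (same constants). -/
theorem locStencilFM_oddHalf {M₂ : Fin (d + 1) → (Fin (d + 1) → ℤ) → Fin (d + 1) → (Fin (d + 1) → ℤ) → MKer (d + 1) (Fib d)} {C δ : ℝ}
    (h : LocStencilFM N M₂ C δ) : LocStencilFM N (fun κ u ρ w => (1 / 2 : ℝ) • (M₂ κ u ρ w - sgnK (trK (M₂ κ u ρ w)))) C δ :=
  fun κ u ρ w => biLoc_half_sub (h κ u ρ w) (biLoc_sgnK_trK (h κ u ρ w))

/-- [folklore] **THE EVEN HALVES OF A SWAP-SYMMETRIC `VertexFamily₂` FORM A `VertexFamily₂` (SAME CONSTANTS)** — the class the W-slot rows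
(hW) of the even member are stated in. -/
theorem vertexFamily₂_evenHalf_of_swap {W : Fin (d + 1) → (Fin (d + 1) → ℤ) → Fin (d + 1) → (Fin (d + 1) → ℤ) → MKer (d + 1) (Fib d)}
    {Cw δ : ℝ} (hs : ∀ μ y ν y', W ν y' μ y = W μ y ν y') (h : VertexFamily₂ W N Cw δ) :
    VertexFamily₂ (fun μ y ν y' => (1 / 2 : ℝ) • (W μ y ν y' + sgnK (trK (W μ y ν y')))) N Cw δ :=
  fun μ y ν y' => biLoc_half_add (h μ y ν y') (vertexFamily₂_sgnK_trK_of_swap hs h μ y ν y')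

/-- [folklore] **THE ODD HALVES OF A SWAP-SYMMETRIC `VertexFamily₂` FORM A `VertexFamily₂` (SAME CONSTANTS)** — the class of the
parity-odd family `X_j` subtracted at the D1 END (`WSlotParityBlind`'s `hX` row is its `Loc` shadow). -/
theorem vertexFamily₂_oddHalf_of_swap {W : Fin (d + 1) → (Fin (d + 1) → ℤ) → Fin (d + 1) → (Fin (d + 1) → ℤ) → MKer (d + 1) (Fib d)}
    {Cw δ : ℝ} (hs : ∀ μ y ν y', W ν y' μ y = W μ y ν y') (h : VertexFamily₂ W N Cw δ) :
    VertexFamily₂ (fun μ y ν y' => (1 / 2 : ℝ) • (W μ y ν y' - sgnK (trK (W μ y ν y')))) N Cw δ :=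
  fun μ y ν y' => biLoc_half_sub (h μ y ν y') (vertexFamily₂_sgnK_trK_of_swap hs h μ y ν y')

end Classes₂


/-! ## §6 At the literal of the recursive wall family: the even half of `WrecAt` -/

section Literal

variable {Lc : ℕ} [NeZero Lc]

/-- [folklore] **THE EVEN HALF OF THE W-LITERAL `WrecAt … j` IS THE SYMMETRISED CARRIER OVER `G_j` ON THE EVEN HALVES OF `T2RecAt … j` AND
`M2Of mixFF j`, MINUS ITS SYMMETRISED SECOND-RESPONSE WORD** (in-block root `toSite r`; every level `j`, every slot pair; the border ∕ mixed
binders `hB`, `hmix` of `SpineRecursiveW` supply the entrywise bounds): §3's `evenHalf_W2SymOfK` at `K := G_j = coDressKBmAt (toSite r) Lc (KInvStep Lc j)`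
(decaying — an2), `S := SpureRecAt … j`, `M := M1At … j` (row-parity-odd — d1-formalise-leaf-05's `trK_SpureRecAt` ∕ `trK_M1At`).  This is the carrier `W′`
that gan24-p2's autonomy step reads (OWNER RULING R-gan24p1-g33-1 (C1)); no induction here. -/
theorem evenHalf_WrecAt (hLc : 1 ≤ Lc) {r : Fin (d + 1) → ℕ} (hr : r ∈ box (d + 1) Lc) (cE cVH cΛ cE₂ cB : ℝ)
    (T : Fin 4 → Fin 4 → Fin 4 → Fin 4 → ℝ) (vh₂S mixFF : Fin (d + 1) → (Fin (d + 1) → ℤ) → Fin (d + 1) → (Fin (d + 1) → ℤ) → MKer (d + 1) (Fib d))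
    (hB : ∃ C δ : ℝ, 0 < δ ∧ LocStencil₂ vh₂S C δ) (hmix : ∃ C δ : ℝ, 0 < δ ∧ LocStencilFM Lc mixFF C δ) (j : ℕ)
    (μ : Fin (d + 1)) (y : Fin (d + 1) → ℤ) (ν : Fin (d + 1)) (y' : Fin (d + 1) → ℤ) :
    (1 / 2 : ℝ) • (WrecAt d Lc (toSite r) cE cVH cΛ cE₂ cB T vh₂S mixFF j μ y ν y'
        + sgnK (trK (WrecAt d Lc (toSite r) cE cVH cΛ cE₂ cB T vh₂S mixFF j μ y ν y'))) =
      W2SymOfK (coDressKBmAt (toSite r) Lc (KInvStep (d := d) Lc j)) Lc (SpureRecAt d Lc (toSite r) cE cVH cΛ j) (M1At d Lc (toSite r) cΛ j)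
          (fun κ u κ' u' => (1 / 2 : ℝ) • (T2RecAt d Lc (toSite r) cE cVH cΛ cE₂ cB T vh₂S mixFF j κ u κ' u'
            + sgnK (trK (T2RecAt d Lc (toSite r) cE cVH cΛ cE₂ cB T vh₂S mixFF j κ u κ' u'))))
          (fun κ u ρ w => (1 / 2 : ℝ) • (M2Of d Lc mixFF j κ u ρ w + sgnK (trK (M2Of d Lc mixFF j κ u ρ w)))) μ y ν y'
        - (1 / 2 : ℝ) • (dM (K2OfK (coDressKBmAt (toSite r) Lc (KInvStep (d := d) Lc j)) Lc (SpureRecAt d Lc (toSite r) cE cVH cΛ j)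
              (M1At d Lc (toSite r) cΛ j) ν y') Lc (SpureRecAt d Lc (toSite r) cE cVH cΛ j) (M1At d Lc (toSite r) cΛ j) μ y
            + dM (K2OfK (coDressKBmAt (toSite r) Lc (KInvStep (d := d) Lc j)) Lc (SpureRecAt d Lc (toSite r) cE cVH cΛ j)
              (M1At d Lc (toSite r) cΛ j) μ y) Lc (SpureRecAt d Lc (toSite r) cE cVH cΛ j) (M1At d Lc (toSite r) cΛ j) ν y') := by
  obtain ⟨C₂, δ₂, hδ₂, hT₂⟩ := T2RecAt_loc cE cVH cΛ cE₂ cB T vh₂S mixFF hLc hr hB hmix j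
  obtain ⟨CM, δM, hδM, hM₂⟩ := hmix
  exact evenHalf_W2SymOfK (N := Lc) (decays_coDressKBmAt_KInvStep (d := d) hr j) (trK_SpureRecAt hLc hr cE cVH cΛ j)
    (fun ρ' w => trK_M1At (toSite r) cΛ j ρ' w) (fun κ u κ' u' x z a b => abs_le_of_locStencil₂ hT₂ hδ₂.le κ u κ' u' x z a b)
    (fun κ u ρ' w x z a b => abs_le_of_locStencilFM (locStencilFM_M2Of hM₂ j) hδM.le κ u ρ' w x z a b) μ y ν y'

/-- [folklore] **THE ODD HALF OF THE W-LITERAL `WrecAt … j` IS THE FULL SYMMETRISED CARRIER OVER `G_j` ON THE ODD HALVES OF `T2RecAt … j` AND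
`M2Of mixFF j`** — the family `X_j` of leaf-01's PARITY-JUNCTION in closed form (§3's `oddHalf_W2SymOfK` at the literal). -/
theorem oddHalf_WrecAt (hLc : 1 ≤ Lc) {r : Fin (d + 1) → ℕ} (hr : r ∈ box (d + 1) Lc) (cE cVH cΛ cE₂ cB : ℝ)
    (T : Fin 4 → Fin 4 → Fin 4 → Fin 4 → ℝ) (vh₂S mixFF : Fin (d + 1) → (Fin (d + 1) → ℤ) → Fin (d + 1) → (Fin (d + 1) → ℤ) → MKer (d + 1) (Fib d))
    (hB : ∃ C δ : ℝ, 0 < δ ∧ LocStencil₂ vh₂S C δ) (hmix : ∃ C δ : ℝ, 0 < δ ∧ LocStencilFM Lc mixFF C δ) (j : ℕ)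
    (μ : Fin (d + 1)) (y : Fin (d + 1) → ℤ) (ν : Fin (d + 1)) (y' : Fin (d + 1) → ℤ) :
    (1 / 2 : ℝ) • (WrecAt d Lc (toSite r) cE cVH cΛ cE₂ cB T vh₂S mixFF j μ y ν y'
        - sgnK (trK (WrecAt d Lc (toSite r) cE cVH cΛ cE₂ cB T vh₂S mixFF j μ y ν y'))) =
      W2SymOfK (coDressKBmAt (toSite r) Lc (KInvStep (d := d) Lc j)) Lc (SpureRecAt d Lc (toSite r) cE cVH cΛ j) (M1At d Lc (toSite r) cΛ j)
        (fun κ u κ' u' => (1 / 2 : ℝ) • (T2RecAt d Lc (toSite r) cE cVH cΛ cE₂ cB T vh₂S mixFF j κ u κ' u'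
          - sgnK (trK (T2RecAt d Lc (toSite r) cE cVH cΛ cE₂ cB T vh₂S mixFF j κ u κ' u'))))
        (fun κ u ρ w => (1 / 2 : ℝ) • (M2Of d Lc mixFF j κ u ρ w - sgnK (trK (M2Of d Lc mixFF j κ u ρ w)))) μ y ν y' := by
  obtain ⟨C₂, δ₂, hδ₂, hT₂⟩ := T2RecAt_loc cE cVH cΛ cE₂ cB T vh₂S mixFF hLc hr hB hmix j
  obtain ⟨CM, δM, hδM, hM₂⟩ := hmix
  exact oddHalf_W2SymOfK (N := Lc) (decays_coDressKBmAt_KInvStep (d := d) hr j) (trK_SpureRecAt hLc hr cE cVH cΛ j)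
    (fun ρ' w => trK_M1At (toSite r) cΛ j ρ' w) (fun κ u κ' u' x z a b => abs_le_of_locStencil₂ hT₂ hδ₂.le κ u κ' u' x z a b)
    (fun κ u ρ' w x z a b => abs_le_of_locStencilFM (locStencilFM_M2Of hM₂ j) hδM.le κ u ρ' w x z a b) μ y ν y'

end Literal

end Summit.QuantumFields.BalabanUV.Beta.GAN24.SecondOrderCarrierParity

end
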